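import Summits.CriticalPhenomena.PercolationContinuityZ3.Theorems.Transplant.AutCylinderCovering
import Summits.CriticalPhenomena.PercolationContinuityZ3.Theorems.Transplant.AutCylinderOfQuasiNode
import Summits.CriticalPhenomena.PercolationContinuityZ3.Theorems.Transplant.SkelFrmQuasiProxHoldsAll
import HarnessLib

/-!
# END-STATE CONTINUITY for FC-SPLIT orbit data: `θ_x(p_c) = 0` at every vertex of every connected locally finite graph carrying a finite-orbit group of
# automorphisms with a rank-two character killing the stabilisers AND an element of non-trivial character with a finite-index centraliser — UNCONDITIONAL
# (the quasi-step node «SkelFrmQuasiProxHoldsAll» + the covering route «AutCylinderCovering»; no growth hypothesis, no Trofimov, no named fact)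

builds on p205010 (kernel theorem, internal audit signed; external expert review pending).  Lane `prim-bschramm`, seat `prim-bschramm-p3` gen 32 (DESIGN OWNER;
RULING L-Q3-2, `P3-NILPOTENT.md` §25).  Helper file (`--supports stmt-CriticalPhenomena-4575 --as helper`).  NOTHING is claimed about the `@[conjecture]`
`BenjaminiSchramm1996_conj4_endState` itself: this file proves its conclusion under ONE extra hypothesis on the orbit datum (an FC element of non-trivial character).

THE THEOREM `AutCyl.conj4_of_orbitDatum_fc`.  Hypotheses = those of `BenjaminiSchramm1996_conj4_endState` («AutEndStateDefs» :37: `A₀ ≤ Aut(G)` with finitely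
many orbits, `c : A₀ →* ℤ²` of rank two with `c a = 1` whenever `a` fixes a vertex) PLUS `(g : A₀) (hg : c g ≠ 1) (N : Subgroup A₀) [N.FiniteIndex]
(hN : ∀ n ∈ N, n * g = g * n)`.  Conclusion: `θ_x(p_c(G)) = 0` at every `x`.
PROOF = the proof of «AutCylinderOfQuasiNode» `endStateCyl_of_quasiNode` with its cylinder hypothesis DISCHARGED: exponential growth — Hutchcroft; otherwise the
tree-chart carrier `Φ` with proxies (`AutChart.exists_frmQuasi_hasProxies`), whose cylinders are fine boxes of the equivariant fine chart `D.chart` (translation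
part `toAdd ∘ D.c`, `D.c = rebase ∘ c`, so `toAdd (D.c g) ≠ 0` from `c g ≠ 1` — §1), hence subcritical at `p_c` by «AutCylinderCovering»
`theta_cylinder_eq_zero_of_commuting` (Martineau–Severo for `G → G/⟨g^m⟩`, the cylinder embedded in the quotient); then the landed node `frmQuasiNodeD` at the
type of `x` and the frame of `x`.
CUSTOMERS (§3): every `A₀` with a CENTRAL element of non-trivial character (`N = ⊤`), e.g. finite-orbit actions of `K × ℤ^k`-type groups with `K` of ANY growth.
[cite: BenjaminiSchramm1996, Conj. 4; §2 (almost transitive graphs)] [cite: MartineauSevero2019, Cor. 2.2] [cite: Hutchcroft2016, Thm. 1.1]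
[cite: KozmaNitzan2024, §4 p. 16 (Lemma 8)]
-/

noncomputable section

namespace Summit.CriticalPhenomena.PercolationContinuityZ3.Theorems.Transplant

namespace AutCyl

open SimpleGraph Literature.Barriers.CriticalPhenomena Literature.Probability.LatticeModels Literature.Probability.Percolation
open scoped Classical

/-! ## §1 The re-based character does not vanish where the character does not -/

/-- If `D.c = rebase ∘ c` for a tree datum `D` (whose character has rank two) then `c g ≠ 1` forces `toAdd (D.c g) ≠ 0`: either the re-basing pair is
independent (then `rebase` is injective) or it is degenerate (then `D.c` would be trivial, contradicting rank two). [folklore] -/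
theorem toAdd_c_ne_zero_of_rebase {V : Type} {G : SimpleGraph V} {A : Type} [Group A] [MulAction A V] (D : AutChart.TreeDatum G A)
    {c : A →* Multiplicative (Site 2)} {u w : Site 2} (hDc : D.c = (AutChart.rebaseHom u w).comp c) {g : A} (hg : c g ≠ 1) :
    Multiplicative.toAdd (D.c g) ≠ 0 := by
  by_cases hdet : MaxArea.det2 u w = 0
  · -- degenerate re-basing: `D.c` is trivial, contradicting the rank of the tree datum
    exfalso
    have h0 : ∀ a : A, Multiplicative.toAdd (D.c a) = 0 := fun a => by
      rw [hDc, MonoidHom.comp_apply, AutChart.toAdd_rebaseHom]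
      funext i
      fin_cases i <;> simp [hdet]
    obtain ⟨a, b, hab⟩ := D.exists_det2_ne_zero
    rw [h0 a, h0 b] at hab
    exact hab (by unfold MaxArea.det2; simp)
  · intro h
    apply hg
    have h1 : MaxArea.rebase u w (Multiplicative.toAdd (c g)) = 0 := by
      rw [← AutChart.toAdd_rebaseHom, ← MonoidHom.comp_apply, ← hDc]; exact h
    have h2 : Multiplicative.toAdd (c g) = 0 := MaxArea.eq_zero_of_rebase_eq_zero hdet h1
    exact toAdd_eq_zero.1 h2

/-! ## §2 The end state for FC-split orbit data -/

/-- **END-STATE CONTINUITY, FC-SPLIT CLASS (unconditional).**  On a connected locally finite graph `G`, let `A₀ ≤ Aut(G)` have finitely many orbits and a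
character `c : A₀ →* ℤ²` of rank two killing every element that fixes a vertex; assume some `g ∈ A₀` with `c g ≠ 1` commutes with a finite-index subgroup
`N ≤ A₀`.  Then `θ_x(p_c(G)) = 0` at EVERY vertex `x`.  No growth hypothesis, no named fact.
builds on p205010 (kernel theorem, internal audit signed; external expert review pending).
[cite: BenjaminiSchramm1996, Conj. 4; §2 (almost transitive graphs)] [cite: MartineauSevero2019, Cor. 2.2] [cite: Hutchcroft2016, Thm. 1.1] -/
theorem conj4_of_orbitDatum_fc {W : Type} (G : SimpleGraph W) [G.LocallyFinite] (hc : G.Connected)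
    (A₀ : Subgroup (G ≃g G)) (reps : Finset W) (c : A₀ →* Multiplicative (Site 2))
    (horb : ∀ w : W, ∃ a : A₀, ∃ s ∈ reps, (a : G ≃g G) s = w) (hstab : ∀ (a : A₀) (w : W), (a : G ≃g G) w = w → c a = 1)
    (hrank : ∃ a b : A₀, MaxArea.det2 (Multiplicative.toAdd (c a)) (Multiplicative.toAdd (c b)) ≠ 0)
    (g : A₀) (hg : c g ≠ 1) (N : Subgroup A₀) [N.FiniteIndex] (hN : ∀ n ∈ N, n * g = g * n)
    (x : W) : theta G x (criticalProbIOf G x) = 0 := by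
  haveI : Countable W := countable_of_connected_of_locallyFinite G hc x
  have hact : IsActionByAut G A₀ := fun a y z => (a : G ≃g G).map_rel_iff'
  have hcover : ∀ w : W, ∃ a : A₀, ∃ s ∈ reps, a • s = w := fun w => by
    obtain ⟨a, s, hs, hw⟩ := horb w
    exact ⟨a, s, hs, hw⟩
  have hq : IsQuasiTransitive G := AutChart.isQuasiTransitive_of_finite_orbits hact reps hcover
  -- exponential growth: Hutchcroft
  by_cases hG : HasExponentialGrowth G
  · exact Hutchcroft2016_noPercolationAtCriticality_holds G hc hq hG x
  -- otherwise: the tree-chart carrier with proxies at every vertex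
  obtain ⟨a₀, t₀, -, -⟩ := hcover x
  have hstab' : ∀ h ∈ MulAction.stabilizer A₀ t₀, c h = 1 := fun h hh => hstab h t₀ (MulAction.mem_stabilizer_iff.1 hh)
  obtain ⟨D, Φ, Dp, u, w, hDc, hφ, hprox⟩ := AutChart.exists_frmQuasi_hasProxies hact hc reps hcover c hstab' hrank hG
  -- `p_c < 1` at every vertex, and the fine chart's translation part does not vanish at `g`
  have hpc : ∀ v : W, criticalProb G v < 1 := fun v => AutChart.criticalProb_lt_one_of_finite_orbits hact hc t₀ reps hcover c hstab' hrank v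
  have hχ : ∀ (a : A₀) (v : W), D.chart (a • v) = Multiplicative.toAdd (D.c a) + D.chart v := fun a v => D.chart_smul a v
  have hτg : Multiplicative.toAdd (D.c g) ≠ 0 := toAdd_c_ne_zero_of_rebase D hDc hg
  -- the frame of `x`
  obtain ⟨t, ht, α, hαt, -⟩ := Φ.frame x
  -- the cylinder hypothesis of the node at `t`, by the covering route
  have hC : Φ.CylSubcritical (criticalProbIOf G t) := by
    intro t' _ ℓ
    have hpct : criticalProbIOf G t' = criticalProbIOf G t := Subtype.ext (criticalProb_eq_of_reachable G (hc.preconnected t' t))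
    have hcyl : Φ.cyl t' ℓ = {v | D.coarse v - D.coarse t' ∈ box 2 ℓ} := by
      show {v | Φ.φ v - Φ.φ t' ∈ box 2 ℓ} = _
      rw [hφ]
    set B : Finset (Site 2) := Fintype.piFinset fun j : Fin 2 =>
      Finset.Icc ((D.N : ℤ) * (D.coarse t' j - ℓ)) ((D.N : ℤ) * (D.coarse t' j + ℓ + 1) - 1) with hB
    have hS : Φ.cyl t' ℓ = {v | D.chart v ∈ (B : Set (Site 2))} := hcyl.trans (D.coarseCyl_eq_fineBox t' ℓ)
    have ht'S : t' ∈ {v | D.chart v ∈ (B : Set (Site 2))} := by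
      rw [← hS]
      show Φ.φ t' - Φ.φ t' ∈ box 2 ℓ
      rw [sub_self]
      exact zero_mem_box 2 ℓ
    have key := theta_cylinder_eq_zero_of_commuting hact hc reps hcover hχ hτg N hN B t' ht'S (hpc t')
    rw [hpct] at key
    exact (AutChart.theta_induce_congr hS _ ht'S (criticalProbIOf G t)).trans key
  have hθt : theta G t (criticalProbIOf G t) = 0 := frmQuasiNodeD G Φ t Dp ht (hprox t) hC
  -- transport to `x = α t`
  have e1 := theta_iso α t (criticalProbIOf G t)
  have e2 : criticalProbIOf G (α t) = criticalProbIOf G t := Subtype.ext (criticalProb_iso α t)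
  rw [← hαt, e2, e1]
  exact hθt

/-! ## §3 The central form (customers: actions of `K × Z`-type groups, `Z` central of non-trivial character) -/

/-- **END STATE, CENTRAL FORM**: if some `g ∈ A₀` with `c g ≠ 1` is CENTRAL in `A₀`, then `θ_x(p_c) = 0` everywhere (the finite-index subgroup is `A₀` itself).
builds on p205010 (kernel theorem, internal audit signed; external expert review pending). [cite: BenjaminiSchramm1996, Conj. 4; §2] [cite: MartineauSevero2019, Cor. 2.2] -/
theorem conj4_of_orbitDatum_central {W : Type} (G : SimpleGraph W) [G.LocallyFinite] (hc : G.Connected)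
    (A₀ : Subgroup (G ≃g G)) (reps : Finset W) (c : A₀ →* Multiplicative (Site 2))
    (horb : ∀ w : W, ∃ a : A₀, ∃ s ∈ reps, (a : G ≃g G) s = w) (hstab : ∀ (a : A₀) (w : W), (a : G ≃g G) w = w → c a = 1)
    (hrank : ∃ a b : A₀, MaxArea.det2 (Multiplicative.toAdd (c a)) (Multiplicative.toAdd (c b)) ≠ 0)
    (g : A₀) (hg : c g ≠ 1) (hcentral : ∀ a : A₀, a * g = g * a) (x : W) : theta G x (criticalProbIOf G x) = 0 := by
  exact conj4_of_orbitDatum_fc G hc A₀ reps c horb hstab hrank g hg ⊤ (fun a _ => hcentral a) x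

end AutCyl

end Summit.CriticalPhenomena.PercolationContinuityZ3.Theorems.Transplant

end
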